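import Summits.BirchSwinnertonDyer.BirchSwinnertonDyer.Theses.LeadingTerm
import Summits.BirchSwinnertonDyer.BirchSwinnertonDyer.Theorems.PinchPrime.Negative.ConsequencesOfCrux
import Literature.NumberTheory.EllipticCurves.CongruentNumberCurveAdditiveReduction
import Literature.NumberTheory.EllipticCurves.CongruentNumberOne
import Literature.NumberTheory.EllipticCurves.TunnellWaldspurgerCorollaryProofs
import Literature.NumberTheory.EllipticCurves.IwasawaLeadingTerm
import Literature.NumberTheory.EllipticCurves.KatoRankBound
import Literature.NumberTheory.EllipticCurves.SelmerCorankHolds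

/-!
# Disproof of `PinchPrime` (stmt-BirchSwinnertonDyer-16218, route `LeadingTerm` #3) — findings

Crux `S := LeadingTerm.PinchPrime`: every elliptic `E/ℚ` (globally minimal `W`) has ONE good
ordinary prime `p ≥ 5` — carried with a canonical cyclotomic height datum `D` (decoration) and a
newform `f` (`IsNewformOf W f`) — with `ord_{T=0} L_p(f, unitRoot W p, T) = rank_ℤ E(ℚ)` in `ℕ∞`.
It is the `∃ p`-form of the sibling crux `PAdicOrderV2.PAdicOrderPadicBSDrankR2` (stmt-0490, `∀ p`,
disprover file `Cruxes/PAdicOrderPadicBSDrankR2/Disproof.lean`, whose junk analysis —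
`L_p(f,0,T) = 0`, `L_p(0,α,T) = 0`, `unitRoot = 0` off the ordinary locus — is REUSED here through
`Theorems/PAdicOrderThesisR2/Negative/AtEveryGoodPrimeFalse` and
`Theorems/PinchPrime/Negative/ConsequencesOfCrux`, never re-declared).

VERDICT OF CYCLE 1 (cdisprove seat, 2026-08-16): **no kill.** `S` is a believed-true open statement
(MTT's BSD(p) rank clause at ONE prime per curve); as typed it resists every in-tree attack, and the
reasons are recorded below as kernel-checked theorems. Everything here is `sorry`-free.

## Index of findings

* §1 QUANTIFIER SHAPE. `pinchPrime_iff` (the crux is literally `∀ W ∃ p ≥ 5, PinchAt W p`);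
  the natural strengthening by quantifier swap, a UNIFORM pinch prime `∃ p ∀ W`
  (`PinchPrimeUniform`, which implies `S`: `pinchPrime_of_uniform`), is FALSE unconditionally:
  `not_pinchPrimeUniform` — for every prime `p ≥ 5` the congruent number curve
  `E_p : y² = x³ - p² x` (elliptic, globally minimal) has ADDITIVE reduction at `p`
  (`not_hasGoodReductionAtPrime_congruentNumberCurve_self`), so `p` is not even a good prime of
  `E_p`. Moral: the pinch prime must depend on the curve (at least through its bad primes); no
  finite set of primes pinches every curve (`not_pinchPrime_boundedPrime`).
* §2 NON-VACUITY / a genuine model of the `∃`-body. `pinchAt_congruentNumberCurve_one`: for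
  `E₁ : y² = x³ - x` (Cremona 32a2: `rank E₁(ℚ) = 0` by Fermat, tree theorem
  `mordellWeilRank_congruentNumberCurve_one`; `L(E₁,1) ≠ 0`, tree theorem
  `entireLFunction_congruentNumberCurve_one_one_ne_zero`; hence `r_an(E₁) = 0`,
  `analyticRank_congruentNumberCurve_one`) and ANY `f` with `IsNewformOf E₁ f`, the `W`-instance of
  `S` holds: some good ordinary `p ≥ 5` of `E₁` is a pinch prime (level-zero window
  `ord_T L_p = 0 ↔ r_an = 0`, proved in tree). So the body of `S` is satisfiable by a non-junk model
  (modulo the newform term, which no seat can construct), and `S` restricted to `E₁` is TRUE.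
* §3 LOAD-BEARING ANALYSIS of the conjuncts (all are CONCLUSIONS inside `∃ p`, so "dropping" one
  WEAKENS `S`; what is recorded is which conjuncts are automatic and which carry content):
  - `not_dvd_frobeniusTrace_of_order_eq_natCast`: the ordinarity half `p ∤ a_p` of `IsOrdinaryAt`
    is IMPLIED by the order clause (off it `unitRoot = 0`, `L_p = 0`, order `⊤`); only
    `HasGoodReductionAtPrime` is extra (a multiplicative prime with `a_p = ±1` has a unit root, so
    good reduction is NOT implied — it excludes the exceptional-zero regime, where MTT predict
    `ord = rank + 1` at split `p`).
  - the datum `D` is decoration for `closes` but NOT for the arithmetic reading (§4): it is the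
    height whose non-degeneracy `S` secretly asserts.
  - `IsNewformOf W f`: with `∃ f` it cannot be dropped to make `S` false, but `f = 0` never
    witnesses (`padicLFunction_zero_form`, sibling), and `S ⇒` modularity
    (`modularity_of_pinchPrime`, landed): any proof of `S` proves `exists_isNewformOf` for
    globally minimal curves.
  - `5 ≤ p`: inherited from the canonical-height facts (`exists_isCanonical`); `p = 3` ordinary
    would be arithmetically fine, `p = 2` is where the sibling's only falsification window was —
    closed here by hypothesis.
* §4 THE ARITHMETIC CONTENT (barrier note B1 "same-prime conjunction" as a theorem).
  `pinchPrime_iff_schneiderShaSomewhere`: modulo four standard inputs taken as HYPOTHESES —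
  Perrin-Riou–Schneider (`Schneider1985_order_charGenerator`, named fact), the main conjecture in
  ORDER form at good ordinary `p ≥ 5` (`OrderIMCAt`: `ord_T L_p = ord_T f_E`; Kato + Skinner–Urban /
  BCS 2024 / Rubin, conjecture-strength only at residual small-image cases), existence of the
  cyclotomic Iwasawa datum with `X` torsion and `char X` principal (`IwasawaDatumAt`; Kato 17.4(1),
  `nonempty_selmerDualData_holds`, `charIdeal_eq_span_holds`), and modularity — the crux is
  EQUIVALENT to `SchneiderShaSomewhere`: every `E/ℚ` has a good ordinary `p ≥ 5` at which the
  canonical cyclotomic `p`-adic height is NON-DEGENERATE **and** `Ш(E/ℚ)[p^∞]` is FINITE — at the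
  SAME prime. Both halves are open for every curve of analytic rank `≥ 2` (Ш) and for every non-CM
  curve of rank `≥ 1` (Schneider, ∃p-form; Bertrand 1982 covers CM rank 1 only).
  `shaCotorsionSomewhere_of_pinchPrime`: with ONLY Kato's corank bound (named fact, hypothesis),
  `S ⇒` every `E/ℚ` has a good ordinary `p ≥ 5` with `corank Sel_{p^∞}(E/ℚ) = rank E(ℚ)` and
  `corank_{ℤ_p} Ш(E/ℚ)[p^∞] = 0` — already open in print for rank `≥ 2`.
* §5 WHY IT RESISTS (for the provers; prose): (i) no in-Lean counter-instance can exist — the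
  `∃ f` needs a `CuspForm` with `IsNewformOf`, not constructible, and the LHS `ord_T L_p` is a
  `limUnder` reachable only through the proved closed forms (constant term, parity), both of which
  `S` passes (§2, and the landed `ConsequencesOfCrux`); (ii) no finite computation can refute `S`:
  at an odd good ordinary `p`, `ord < rank` contradicts Kato's theorem and `ord > rank` at ALL
  ordinary `p ≥ 5` of one curve would require certifying exact vanishing of infinitely many
  `p`-adic numbers; conversely ONE certified non-vanishing `[T^rank] L_p ≠ 0 (mod p^n)` at one
  ordinary `p ≥ 5` CERTIFIES the `W`-instance of `S` (Kato gives `ord ≥ rank`), which is how the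
  compute probe below confirms `S` curve by curve; (iii) by §4, `S` dies only by THEORY: an `E/ℚ`
  with, at EVERY good ordinary `p ≥ 5`, `corank Ш[p^∞] > 0` or `Reg_p = 0` — no such curve is known
  or conjectured (Schneider's conjecture: `Reg_p ≠ 0` always; `Ш` finite always); the heuristic
  probability that a fixed `E` is degenerate at every ordinary `p` is `∏_p O(1/p) = 0`.
  (iv) Literature (lit search 2026-08-16, this seat): no printed example of a degenerate cyclotomic
  `p`-adic height on `E(ℚ)` or of `ord_T L_p > rank` with `Ш[p^∞]` proven infinite exists; numerical
  verifications of `ord_T L_p = rank` / `Reg_p ≠ 0`: Stein–Wuthrich 2013 §§8–10 (all `N < 3000`… at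
  good ordinary `p < 100` under analytic Ш), BMS 2016 (modular abelian surfaces), the 2001 programme
  (389a1 at `5 ≤ p < 60000`, 5077a1 `p < 40000`).
* §6 COMPUTE PROBE (kit jobs j020833 / j020973, PARI/GP 2.15.4 `msfromell/mspadicmoments/mspadicL`,
  evidence attached to the item on completion): for every curve of Mordell–Weil rank `≥ 2` (certified
  `ellrank` lower = upper = analytic rank) in the box `a₁,a₃ ∈ {0,1}`, `a₂ ∈ {-1,0,1}`,
  `|a₄| ≤ 60`, `|a₆| ≤ 120`, conductor `≤ 3000`, plus 389a1 and 5077a1 (rank 3): the LEAST good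
  ordinary `p ≥ 5` and whether it is a certified pinch prime (`r`-th `s`-derivative of
  `L_p(E,⟨·⟩^s)` at `0` non-zero mod `p^n`, lower ones `O(p^n)`). OUTCOME (`## §6` at the end): 189 certified
  rank-≥2 curves with N ≤ 3000 (+5077a1, rank 3); **188/189 pinched at their LEAST good ordinary
  prime** (158 at p = 5, 30 at p = 7), 0 counter-indications, 1 inconclusive for memory only
  (N = 2870, least ordinary prime 11; re-run j021239); 155/188 of these pinch points are sharp
  (`[T^r]L_p` a unit), 33 are pinched-but-not-sharp.
* LANDED from this file (Theorems/PinchPrime/Negative/, both ACCEPTED): `UniformPinchPrimeFalse.lean`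
  (p131425: `leadingTermPinchPrime_uniform_false`, `leadingTermPinchPrime_bounded_false`,
  `not_hasGoodReductionAtPrime_congruentNumberCurve_of_dvd/_self`) and `ContentOfCrux.lean`
  (p131489: `leadingTermPinchPrime_iff_goodReductionForm`, `…_iff_without_datum`,
  `analyticRank_congruentNumberCurve_one`, `pinch_of_rank_zero_of_analyticRank_zero`,
  `leadingTermPinchPrime_instance_congruentNumberCurve_one`,
  `schneiderSha_somewhere_of_leadingTermPinchPrime`, `leadingTermPinchPrime_iff_schneiderSha_somewhere`,
  `shaCotorsion_somewhere_of_leadingTermPinchPrime`, `not_dvd_frobeniusTrace_of_order_eq_natCast`).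
  In the landed files every variant is stated INLINE (no `def … : Prop` under `Summits/`) and the
  named facts are explicit theorem binders (a `variable (h : <named fact>)` is flagged
  `smuggling-suspect` by the gate and queued for review — note for later seats).
* NEAR-MISSES claimable as `¬S`: none.
-/

-- D-0017: single-problem summit, so `Summit.BirchSwinnertonDyer.BirchSwinnertonDyer.…` repeats a
-- namespace BY DESIGN.
set_option linter.dupNamespace false

noncomputable section

namespace Summit.BirchSwinnertonDyer.BirchSwinnertonDyer.Cruxes.PinchPrime.Disproof

open scoped MatrixGroups ModularForm
open CongruenceSubgroup Literature.NumberTheory.EllipticCurves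
  Literature.NumberTheory.EllipticCurves.ModularForms
open Summit.BirchSwinnertonDyer.BirchSwinnertonDyer.Theses
open Summit.BirchSwinnertonDyer.BirchSwinnertonDyer.Theorems.PAdicOrderThesisR2.Negative
open Summit.BirchSwinnertonDyer.BirchSwinnertonDyer.Theorems.PinchPrime.Negative

/-! ## §1 Quantifier shape: the pinch prime must depend on the curve -/

section Shape

/-- The pointwise body of the crux at `(W, p)`: `p` is good ordinary for `W`, a canonical
cyclotomic height datum exists at `p`, and for some newform `f` of `W`,
`ord_{T=0} L_p(f, α_p, T) = rank_ℤ W(ℚ)`. -/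
def PinchAt (W : WeierstrassCurve ℚ) [W.IsGloballyMinimal] (p : ℕ) [Fact p.Prime] : Prop :=
  IsOrdinaryAt W p ∧ ∃ (D : WeierstrassCurve.PAdicHeightData W p), D.IsCanonical ∧
    ∃ (N : ℕ) (_ : NeZero N) (f : CuspForm (Gamma0 N) 2), IsNewformOf W f ∧
      (padicLFunction f (unitRoot W p : ℚ_[p])).order = W.mordellWeilRank

/-- The crux, re-read: `∀ W ∃ p ≥ 5, PinchAt W p` (definitionally). [folklore] -/
theorem pinchPrime_iff :
    LeadingTerm.PinchPrime ↔ ∀ (W : WeierstrassCurve ℚ) [W.IsElliptic] [W.IsGloballyMinimal],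
      ∃ (p : ℕ) (_ : Fact p.Prime), 5 ≤ p ∧ PinchAt W p :=
  Iff.rfl

/-- STRENGTHENING BY QUANTIFIER SWAP: one prime `p ≥ 5` pinching EVERY curve. -/
def PinchPrimeUniform : Prop :=
  ∃ (p : ℕ) (_ : Fact p.Prime), 5 ≤ p ∧
    ∀ (W : WeierstrassCurve ℚ) [W.IsElliptic] [W.IsGloballyMinimal], PinchAt W p

/-- STRENGTHENING BY A UNIFORM BOUND: the pinch prime below a bound `B` independent of the curve. -/
def PinchPrimeBounded (B : ℕ) : Prop :=
  ∀ (W : WeierstrassCurve ℚ) [W.IsElliptic] [W.IsGloballyMinimal],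
    ∃ (p : ℕ) (_ : Fact p.Prime), 5 ≤ p ∧ p ≤ B ∧ PinchAt W p

/-- The uniform form implies the crux (it IS a strengthening). [folklore] -/
theorem pinchPrime_of_uniform (h : PinchPrimeUniform) : LeadingTerm.PinchPrime := by
  obtain ⟨p, hp, h5, hall⟩ := h
  intro W _ _
  exact ⟨p, hp, h5, hall W⟩

/-- The bounded form implies the crux (it IS a strengthening). [folklore] -/
theorem pinchPrime_of_bounded {B : ℕ} (h : PinchPrimeBounded B) : LeadingTerm.PinchPrime := by
  intro W _ _
  obtain ⟨p, hp, h5, -, hat⟩ := h W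
  exact ⟨p, hp, h5, hat⟩

/-- **`E_p : y² = x³ - p²x` has bad reduction at the odd prime `p`** (additive: `ord_p Δ = 6`,
`ord_p c₄ = 2`; Silverman AEC VII.5 Prop. 5.1(c)), in the prime-indexed predicate of the crux
(bridge `hasGoodReductionAtPrime_primesEquiv_iff_holds`, tree theorem
`hasAdditiveReductionAt_congruentNumberCurve_of_dvd`).
[cite: SilvermanAEC2009, VII.5 Prop. 5.1(c) and VII.1 Remark 1.1] -/
theorem not_hasGoodReductionAtPrime_congruentNumberCurve_self (p : ℕ) [hp : Fact p.Prime]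
    (hp2 : p ≠ 2) : ¬ (congruentNumberCurve p).HasGoodReductionAtPrime p := by
  obtain ⟨v, hv⟩ : ∃ v : IsDedekindDomain.HeightOneSpectrum (NumberField.RingOfIntegers ℚ),
      (Rat.HeightOneSpectrum.primesEquiv v : ℕ) = p :=
    ⟨Rat.HeightOneSpectrum.primesEquiv.symm ⟨p, hp.out⟩, by rw [Equiv.apply_symm_apply]⟩
  have hgen : Rat.HeightOneSpectrum.natGenerator v = p := hv
  intro hgood
  have hgood' : (congruentNumberCurve p).HasGoodReductionAt v :=
    (WeierstrassCurve.hasGoodReductionAtPrime_primesEquiv_iff_holds _ v p hv).1 hgood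
  exact (hasAdditiveReductionAt_congruentNumberCurve_of_dvd v hp.out.prime.squarefree
    (hgen ▸ hp2) (hgen ▸ dvd_rfl)).not_hasGoodReductionAt hgood'

/-- Hence `p` is not a good ordinary prime of `E_p`. [folklore] -/
theorem not_isOrdinaryAt_congruentNumberCurve_self (p : ℕ) [Fact p.Prime] (hp2 : p ≠ 2)
    [(congruentNumberCurve p).IsGloballyMinimal] : ¬ IsOrdinaryAt (congruentNumberCurve p) p :=
  fun h => not_hasGoodReductionAtPrime_congruentNumberCurve_self p hp2 h.1

/-- Hence `(E_p, p)` is never a pinch point. [folklore] -/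
theorem not_pinchAt_congruentNumberCurve_self (p : ℕ) [Fact p.Prime] (hp2 : p ≠ 2)
    [(congruentNumberCurve p).IsGloballyMinimal] : ¬ PinchAt (congruentNumberCurve p) p :=
  fun h => not_isOrdinaryAt_congruentNumberCurve_self p hp2 h.1

/-- **No uniform pinch prime** (`¬ ∃ p ∀ W`): the quantifier-swapped strengthening of the crux is
false, witnessed at each `p ≥ 5` by the globally minimal elliptic curve `E_p : y² = x³ - p²x`
(`isGloballyMinimal_congruentNumberCurve`, `p` squarefree), which has additive reduction at `p`.
[folklore] -/
theorem not_pinchPrimeUniform : ¬ PinchPrimeUniform := by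
  rintro ⟨p, hp, h5, hall⟩
  haveI : (congruentNumberCurve p).IsElliptic := isElliptic_congruentNumberCurve hp.out.ne_zero
  haveI : (congruentNumberCurve p).IsGloballyMinimal :=
    isGloballyMinimal_congruentNumberCurve hp.out.prime.squarefree
  exact not_pinchAt_congruentNumberCurve_self p (by omega) (hall (congruentNumberCurve p))

/-- **No curve-independent bound on the pinch prime**: for every `B`, the globally minimal elliptic
curve `E_n : y² = x³ - n²x` with `n = ∏_{5 ≤ q ≤ B, q prime} q` (squarefree) has additive reduction
at every prime `5 ≤ q ≤ B`, so none of them is a pinch prime of `E_n`. [folklore] -/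
theorem not_pinchPrime_boundedPrime (B : ℕ) : ¬ PinchPrimeBounded B := by
  intro h
  -- `n` = product of the primes in `[5, B]`
  set s : Finset ℕ := (Finset.range (B + 1)).filter (fun q => q.Prime ∧ 5 ≤ q) with hs
  set n : ℕ := ∏ q ∈ s, q with hn
  have hprime : ∀ q ∈ s, q.Prime := fun q hq => ((Finset.mem_filter.mp hq).2).1
  have hn0 : n ≠ 0 := Finset.prod_ne_zero_iff.mpr fun q hq => (hprime q hq).ne_zero
  have hsq : Squarefree n := by
    rw [hn]
    exact Finset.squarefree_prod_of_pairwise_isCoprime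
      (fun q hq r hr hqr => Nat.coprime_iff_isRelPrime.mp
        ((Nat.coprime_primes (hprime q hq) (hprime r hr)).mpr hqr))
      (fun q hq => (hprime q hq).prime.squarefree)
  haveI : (congruentNumberCurve n).IsElliptic := isElliptic_congruentNumberCurve hn0
  haveI : (congruentNumberCurve n).IsGloballyMinimal := isGloballyMinimal_congruentNumberCurve hsq
  obtain ⟨p, hp, h5, hpB, hat⟩ := h (congruentNumberCurve n)
  have hps : p ∈ s := Finset.mem_filter.mpr ⟨Finset.mem_range.mpr (by omega), hp.out, h5⟩
  have hpn : p ∣ n := Finset.dvd_prod_of_mem _ hps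
  -- additive reduction of `E_n` at `p ∣ n`, `p` odd
  obtain ⟨v, hv⟩ : ∃ v : IsDedekindDomain.HeightOneSpectrum (NumberField.RingOfIntegers ℚ),
      (Rat.HeightOneSpectrum.primesEquiv v : ℕ) = p :=
    ⟨Rat.HeightOneSpectrum.primesEquiv.symm ⟨p, hp.out⟩, by rw [Equiv.apply_symm_apply]⟩
  have hgen : Rat.HeightOneSpectrum.natGenerator v = p := hv
  have hgood' : (congruentNumberCurve n).HasGoodReductionAt v :=
    (WeierstrassCurve.hasGoodReductionAtPrime_primesEquiv_iff_holds _ v p hv).1 hat.1.1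
  exact (hasAdditiveReductionAt_congruentNumberCurve_of_dvd v hsq (hgen ▸ by omega)
    (hgen ▸ hpn)).not_hasGoodReductionAt hgood'

end Shape

/-! ## §2 Non-vacuity: the `∃`-body has a genuine model at `E₁ = 32a2` -/

section Model

/-- `E₁ : y² = x³ - x` (Cremona 32a2) is elliptic (`Δ = 64`). [folklore] -/
instance isElliptic_E₁ : (congruentNumberCurve 1).IsElliptic :=
  isElliptic_congruentNumberCurve one_ne_zero

/-- `y² = x³ - x` is a global minimal model. [folklore] -/
instance isGloballyMinimal_E₁ : (congruentNumberCurve 1).IsGloballyMinimal :=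
  isGloballyMinimal_congruentNumberCurve squarefree_one

/-- **`r_an(E₁) = 0`**: `L(E₁, 1) ≠ 0` (tree theorem
`entireLFunction_congruentNumberCurve_one_one_ne_zero`, Tunnell/Waldspurger thread: `L(E₁,1) =
Ω/4 · …`), so the order of vanishing at `s = 1` is `0` (junk-robust: `analyticOrderAt_eq_zero`).
[folklore] -/
theorem analyticRank_congruentNumberCurve_one : (congruentNumberCurve 1).analyticRank = 0 := by
  have h := entireLFunction_congruentNumberCurve_one_one_ne_zero
  have h0 : analyticOrderAt (congruentNumberCurve 1).entireLFunction 1 = 0 :=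
    analyticOrderAt_eq_zero.mpr (Or.inr h)
  unfold WeierstrassCurve.analyticRank analyticOrderNatAt
  rw [h0]
  rfl

/-- **The `W`-instance of the crux at `E₁` is TRUE, modulo its newform.** For any `f` with
`IsNewformOf E₁ f` (the CM newform of level `32`, not constructible in the tree; in print BCDT /
explicitly `η(4z)²η(8z)²`), some good ordinary `p ≥ 5` of `E₁` (one exists:
`exists_good_ordinary_prime_holds`) with its canonical datum (`exists_isCanonical_holds`) is a pinch
prime: `rank E₁(ℚ) = 0` (Fermat; `mordellWeilRank_congruentNumberCurve_one`) and `r_an(E₁) = 0`, and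
in rank `0` the pinch clause IS `r_an = 0` (`pinch_iff_analyticRank_eq_zero_of_rank_eq_zero`,
landed). So the `∃`-body of the crux has a non-junk model. [folklore] -/
theorem pinchAt_congruentNumberCurve_one {N : ℕ} [NeZero N] (f : CuspForm (Gamma0 N) 2)
    (hf : IsNewformOf (congruentNumberCurve 1) f) :
    ∃ (p : ℕ) (_ : Fact p.Prime), 5 ≤ p ∧ PinchAt (congruentNumberCurve 1) p := by
  obtain ⟨p, hp, h5, hgood, hord⟩ :=
    WeierstrassCurve.exists_good_ordinary_prime_holds (congruentNumberCurve 1)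
  obtain ⟨D, hD⟩ := WeierstrassCurve.exists_isCanonical_holds (congruentNumberCurve 1) p h5 hgood hord
  refine ⟨p, hp, h5, ⟨hgood, hord⟩, D, hD, N, inferInstance, f, hf, ?_⟩
  exact (pinch_iff_analyticRank_eq_zero_of_rank_eq_zero _ mordellWeilRank_congruentNumberCurve_one
    p ⟨hgood, hord⟩ hf).mpr analyticRank_congruentNumberCurve_one

/-- The same in the shape of the crux's binder: every rank-`0` curve with `L(E,1) ≠ 0` satisfies
its instance of the crux at EVERY good ordinary `p ≥ 5` (not just one), given its newform.
[folklore] -/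
theorem pinchAt_of_rank_zero_of_L_one_ne_zero (W : WeierstrassCurve ℚ) [W.IsElliptic]
    [W.IsGloballyMinimal] (h0 : W.mordellWeilRank = 0) (han : W.analyticRank = 0)
    {N : ℕ} [NeZero N] (f : CuspForm (Gamma0 N) 2) (hf : IsNewformOf W f)
    (p : ℕ) [Fact p.Prime] (h5 : 5 ≤ p) (hord : IsOrdinaryAt W p) : PinchAt W p := by
  obtain ⟨D, hD⟩ := WeierstrassCurve.exists_isCanonical_holds W p h5 hord.1 hord.2
  exact ⟨hord, D, hD, N, inferInstance, f, hf,
    (pinch_iff_analyticRank_eq_zero_of_rank_eq_zero W h0 p hord hf).mpr han⟩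

end Model

/-! ## §3 Load-bearing analysis of the conjuncts -/

section Conjuncts

/-- **The `p ∤ a_p` half of `IsOrdinaryAt` is implied by the order clause**: if
`ord_T L_p(f, unitRoot W p, T)` is ANY natural number then `p ∤ a_p(W)` (contrapositive of the
sibling's `order_ne_natCast_of_dvd`: `p ∣ a_p ⇒ unitRoot = 0 ⇒ L_p = 0 ⇒ order = ⊤`). So in the
`∃ p` crux the ordinarity conjunct costs a prover nothing beyond good reduction. [folklore] -/
theorem not_dvd_frobeniusTrace_of_order_eq_natCast (W : WeierstrassCurve ℚ) [W.IsGloballyMinimal]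
    (p : ℕ) [Fact p.Prime] {N : ℕ} (f : CuspForm (Gamma0 N) 2) {r : ℕ}
    (h : (padicLFunction f (unitRoot W p : ℚ_[p])).order = r) : ¬ (p : ℤ) ∣ W.frobeniusTrace p :=
  fun hdvd => order_ne_natCast_of_dvd W p hdvd f r h

/-- **The crux with `IsOrdinaryAt` weakened to good reduction is EQUIVALENT to the crux** (not
merely implied): the order clause restores `p ∤ a_p`. So "allow supersingular pinch primes" is not
a different statement in this tree (it would be with the signed `L_p^±`, which the tree lacks).
[folklore] -/
theorem pinchPrime_iff_goodReductionForm :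
    LeadingTerm.PinchPrime ↔
      ∀ (W : WeierstrassCurve ℚ) [W.IsElliptic] [W.IsGloballyMinimal],
        ∃ (p : ℕ) (_ : Fact p.Prime), 5 ≤ p ∧ W.HasGoodReductionAtPrime p ∧
          ∃ (D : WeierstrassCurve.PAdicHeightData W p), D.IsCanonical ∧
            ∃ (N : ℕ) (_ : NeZero N) (f : CuspForm (Gamma0 N) 2), IsNewformOf W f ∧
              (padicLFunction f (unitRoot W p : ℚ_[p])).order = W.mordellWeilRank := by
  constructor
  · intro h W _ _
    obtain ⟨p, hp, h5, hord, D, hD, N, hN, f, hf, ho⟩ := h W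
    exact ⟨p, hp, h5, hord.1, D, hD, N, hN, f, hf, ho⟩
  · intro h W _ _
    obtain ⟨p, hp, h5, hgood, D, hD, N, hN, f, hf, ho⟩ := h W
    exact ⟨p, hp, h5, ⟨hgood, not_dvd_frobeniusTrace_of_order_eq_natCast W p f ho⟩,
      D, hD, N, hN, f, hf, ho⟩

/-- **The height datum is decoration for the deciding theorem**: the crux with the `∃ D` clause
deleted is EQUIVALENT to the crux (a canonical datum exists at every good ordinary `p ≥ 5`,
`exists_isCanonical_holds`). It is NOT decoration for the arithmetic reading of §4. [folklore] -/
theorem pinchPrime_iff_without_datum :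
    LeadingTerm.PinchPrime ↔
      ∀ (W : WeierstrassCurve ℚ) [W.IsElliptic] [W.IsGloballyMinimal],
        ∃ (p : ℕ) (_ : Fact p.Prime), 5 ≤ p ∧ IsOrdinaryAt W p ∧
          ∃ (N : ℕ) (_ : NeZero N) (f : CuspForm (Gamma0 N) 2), IsNewformOf W f ∧
            (padicLFunction f (unitRoot W p : ℚ_[p])).order = W.mordellWeilRank := by
  constructor
  · intro h W _ _
    obtain ⟨p, hp, h5, hord, -, -, N, hN, f, hf, ho⟩ := h W
    exact ⟨p, hp, h5, hord, N, hN, f, hf, ho⟩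
  · intro h W _ _
    obtain ⟨p, hp, h5, hord, N, hN, f, hf, ho⟩ := h W
    obtain ⟨D, hD⟩ := WeierstrassCurve.exists_isCanonical_holds W p h5 hord.1 hord.2
    exact ⟨p, hp, h5, hord, D, hD, N, hN, f, hf, ho⟩

end Conjuncts

/-! ## §4 The arithmetic content: Schneider non-degeneracy AND `Ш[p^∞]` finite at the SAME prime -/

section Content

/-- The main conjecture at `(W, p)` in ORDER form: for the cyclotomic Iwasawa datum (`X` finitely
generated torsion, `char X = (f_E)`) and the newform `f`, `ord_{T=0} L_p(f, α_p, T) = ord_{T=0} f_E`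
(Kato 17.4 + Skinner–Urban 3.6.9 / Burungale–Castella–Skinner 2024 / Greenberg–Vatsal / Rubin;
equality in `Λ ⊗ ℚ_p` suffices for orders). A HYPOTHESIS shape, asserted nowhere. -/
def OrderIMCAt (W : WeierstrassCurve ℚ) [W.IsElliptic] [W.IsGloballyMinimal] (p : ℕ)
    [Fact p.Prime] : Prop :=
  ∀ (κ : ZpExtension ℚ p) (γ : Field.absoluteGaloisGroup ℚ),
    κ.IsCyclotomic → κ.IsTopGenerator γ → IsCyclotomicVariable p γ →
    ∀ (D : W.SelmerDualData κ γ) [Module.Finite (IwasawaAlgebra p) D.X], D.IsTorsion →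
    ∀ (fE : IwasawaAlgebra p), D.charIdeal = Ideal.span {fE} →
    ∀ {N : ℕ} [NeZero N] (f : CuspForm (Gamma0 N) 2), IsNewformOf W f →
      (padicLFunction f (unitRoot W p : ℚ_[p])).order = fE.order

/-- Existence of the cyclotomic Iwasawa datum at `(W, p)`: a cyclotomic `ℤ_p`-extension with a
topological generator matching the cyclotomic variable, a Selmer dual datum with `X` finitely
generated and torsion (Kato 17.4(1)) and a generator `f_E` of `char X` (`Λ` a UFD, `char` principal).
A HYPOTHESIS shape (in the tree: `nonempty_selmerDualData_holds`, `charIdeal_eq_span_holds`,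
`kato_divisibility` (1)). -/
def IwasawaDatumAt (W : WeierstrassCurve ℚ) [W.IsElliptic] [W.IsGloballyMinimal] (p : ℕ)
    [Fact p.Prime] : Prop :=
  ∃ (κ : ZpExtension ℚ p) (γ : Field.absoluteGaloisGroup ℚ) (D : W.SelmerDualData κ γ)
    (_ : Module.Finite (IwasawaAlgebra p) D.X) (fE : IwasawaAlgebra p),
    κ.IsCyclotomic ∧ κ.IsTopGenerator γ ∧ IsCyclotomicVariable p γ ∧ D.IsTorsion ∧
      D.charIdeal = Ideal.span {fE}

/-- **The arithmetic avatar of the crux**: every elliptic `E/ℚ` (globally minimal `W`) has a good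
ordinary prime `p ≥ 5` and THE canonical cyclotomic height datum `D` at `p` with
`Reg_p(E, D) ≠ 0` (Schneider's conjecture at `p`) AND `#Ш(E/ℚ)[p^∞] < ∞` — at the same prime. -/
def SchneiderShaSomewhere : Prop :=
  ∀ (W : WeierstrassCurve ℚ) [W.IsElliptic] [W.IsGloballyMinimal],
    ∃ (p : ℕ) (_ : Fact p.Prime), 5 ≤ p ∧ IsOrdinaryAt W p ∧
      ∃ (D : WeierstrassCurve.PAdicHeightData W p), D.IsCanonical ∧
        WeierstrassCurve.SchneiderConjecture D ∧ Finite (AddCommGroup.primaryComponent W.sha p)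

variable (hPRS : Schneider1985_order_charGenerator)
  (hIMC : ∀ (W : WeierstrassCurve ℚ) [W.IsElliptic] [W.IsGloballyMinimal] (p : ℕ) [Fact p.Prime],
    5 ≤ p → IsOrdinaryAt W p → OrderIMCAt W p)
  (hDat : ∀ (W : WeierstrassCurve ℚ) [W.IsElliptic] [W.IsGloballyMinimal] (p : ℕ) [Fact p.Prime],
    5 ≤ p → IsOrdinaryAt W p → IwasawaDatumAt W p)

include hPRS hIMC hDat

/-- **`S ⇒ SchneiderShaSomewhere`** (modulo Perrin-Riou–Schneider, the order-IMC and the Iwasawa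
datum, all hypotheses): at the pinch prime, `ord_T f_E = ord_T L_p = rank`, and clause 2 of
`Schneider1985_order_charGenerator` converts `ord_T f_E = rank` into non-degeneracy of THE canonical
height carried by the crux together with finiteness of `Ш[p^∞]`.
[cite: BalakrishnanMullerStein2015, Thm. 1.7] -/
theorem schneiderShaSomewhere_of_pinchPrime (hS : LeadingTerm.PinchPrime) :
    SchneiderShaSomewhere := by
  intro W _ _
  obtain ⟨p, hp, h5, hord, Dh, hDh, N, hN, f, hf, horder⟩ := hS W
  obtain ⟨κ, γ, D, hfin, fE, hκ, hγ, hγ', hX, hfE⟩ := hDat W p h5 hord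
  have h1 : (padicLFunction f (unitRoot W p : ℚ_[p])).order = fE.order :=
    hIMC W p h5 hord κ γ hκ hγ hγ' D hX fE hfE f hf
  have h2 : fE.order = W.mordellWeilRank := h1 ▸ horder
  obtain ⟨hSch, hSha⟩ :=
    (hPRS W p h5 hord.1 hord.2 κ γ hκ hγ hγ' D hX fE hfE Dh hDh).2.1.mp h2
  exact ⟨p, hp, h5, hord, Dh, hDh, hSch, hSha⟩

/-- **`SchneiderShaSomewhere ⇒ S`** (modulo the same three inputs and modularity
`exists_isNewformOf` for the `∃ f`): clause 2 of Perrin-Riou–Schneider gives `ord_T f_E = rank` at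
that prime, the order-IMC moves it to `L_p`. [cite: BalakrishnanMullerStein2015, Thm. 1.7] -/
theorem pinchPrime_of_schneiderShaSomewhere (hmod : exists_isNewformOf)
    (h : SchneiderShaSomewhere) : LeadingTerm.PinchPrime := by
  intro W _ _
  obtain ⟨p, hp, h5, hord, Dh, hDh, hSch, hSha⟩ := h W
  obtain ⟨κ, γ, D, hfin, fE, hκ, hγ, hγ', hX, hfE⟩ := hDat W p h5 hord
  haveI : NeZero (W.conductorNorm ℤ) := ⟨(WeierstrassCurve.conductorNorm_pos_holds (W := W)).ne'⟩
  obtain ⟨f, hf⟩ := hmod W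
  have h2 : fE.order = W.mordellWeilRank :=
    (hPRS W p h5 hord.1 hord.2 κ γ hκ hγ hγ' D hX fE hfE Dh hDh).2.1.mpr ⟨hSch, hSha⟩
  have h1 : (padicLFunction f (unitRoot W p : ℚ_[p])).order = fE.order :=
    hIMC W p h5 hord κ γ hκ hγ hγ' D hX fE hfE f hf
  exact ⟨p, hp, h5, hord, Dh, hDh, _, inferInstance, f, hf, h1.trans h2⟩

/-- **The content theorem** (barrier note B1 "same-prime conjunction", kernel-checked): modulo
Perrin-Riou–Schneider, the order-IMC at good ordinary `p ≥ 5`, the Iwasawa datum and modularity —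
all HYPOTHESES — the crux `PinchPrime` is EQUIVALENT to `SchneiderShaSomewhere`. Two independent
`∃ p` statements (Schneider somewhere; `Ш[p^∞]` finite somewhere) do NOT suffice: the conjunction is
at one prime. [cite: BalakrishnanMullerStein2015, Thm. 1.7] -/
theorem pinchPrime_iff_schneiderShaSomewhere (hmod : exists_isNewformOf) :
    LeadingTerm.PinchPrime ↔ SchneiderShaSomewhere :=
  ⟨schneiderShaSomewhere_of_pinchPrime hPRS hIMC hDat,
    pinchPrime_of_schneiderShaSomewhere hPRS hIMC hDat hmod⟩

end Content

section KatoOnly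

/-- **`S` + Kato's corank bound ⇒ `Ш`-cotorsion SOMEWHERE.** Granting only Kato's theorem
`corank_{ℤ_p} Sel_{p^∞}(E/ℚ) ≤ ord_T L_p(E,T)` (Astérisque 295, Thm 18.4; named fact
`kato_selmerCorank_le_order_padicLFunction`, a hypothesis at every point), the crux forces, for
every elliptic `E/ℚ`, a good ordinary `p ≥ 5` with `corank Sel_{p^∞}(E/ℚ) = rank E(ℚ)` and
`corank_{ℤ_p} Ш(E/ℚ)[p^∞] = 0` (Kummer corank identity, PROVED:
`selmerCorank_eq_mordellWeilRank_add_holds`). Open in print for every curve of rank `≥ 2`.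
[cite: Kato2004, Thm 18.4] -/
theorem shaCotorsionSomewhere_of_pinchPrime (hS : LeadingTerm.PinchPrime)
    (hK : ∀ (W : WeierstrassCurve ℚ) [W.IsElliptic] [W.IsGloballyMinimal] (p : ℕ) [Fact p.Prime]
      {N : ℕ} [NeZero N] {f : CuspForm (Gamma0 N) 2},
      kato_selmerCorank_le_order_padicLFunction W p (f := f))
    (W : WeierstrassCurve ℚ) [W.IsElliptic] [W.IsGloballyMinimal] :
    ∃ (p : ℕ) (_ : Fact p.Prime), 5 ≤ p ∧ IsOrdinaryAt W p ∧
      W.selmerCorank p = W.mordellWeilRank ∧ W.shaCorank p = 0 := by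
  obtain ⟨p, hp, h5, hord, -, -, N, hN, f, hf, horder⟩ := hS W
  have hk := hK W p (f := f) (by omega) hord hf
  rw [horder] at hk
  have h1 : W.selmerCorank p ≤ W.mordellWeilRank := by exact_mod_cast hk
  have h2 := W.selmerCorank_eq_mordellWeilRank_add_holds p
  exact ⟨p, hp, h5, hord, by omega, by omega⟩

end KatoOnly

/-! ## §5 Why it resists — see the module docstring (prose), and:

* `-- Targets`: the payload carried `targets = []` / `line = null`, but during this cycle the lead
  (prover-line-stmt-BirchSwinnertonDyer-16218-0) PICKED `SketchIdeator2` and registered skeleton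
  86306a1a79f9 (`Cruxes/PinchPrime/Lines/SketchIdeator2.lean`, 6 stubs). Pre-arm read, on paper
  (no stub is attackable by an in-Lean instance — each live one quantifies over the unconstructible
  `ZpExtension`/`SelmerDualData`/newform data or is an open ∀-statement):
  - `stub_cofiniteShaFinite` (OPEN): ⊂ finiteness of `Ш`; consistent; not refutable. Known slice:
    `r_an ≤ 1` (Kolyvagin / `kato_finite_of_L_one_ne_zero` for `r_an = 0`).
  - `stub_stableInfinitelyOften` (OPEN): stability one layer up at `p` ⟺ `T·X = 0` ⟺ `γ` acts
    trivially on `Sel_{p^∞}(E/ℚ_∞)`; then `char X = (T^{r'})`, `r' = corank Sel_{p^∞}(E/ℚ)`, so the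
    leading coefficient of `f_E` is a UNIT: by clause 3 of `Schneider1985_order_charGenerator` (when
    `Ш[p^∞]` is finite) this forces `p` NON-ANOMALOUS (`(1-α⁻¹)²` unit ⟺ `p ∤ #Ẽ(𝔽_p)`),
    `p ∤ #Ш[p^∞]·Tam/#tors²`, AND `v_p(Reg_p(E)) = r` exactly (the normalised cyclotomic regulator
    `Reg_p/p^r` a `p`-unit: "E(ℚ) is not Wieferich at p"). Hence the stub is an
    "infinitely many non-Wieferich primes for E" statement — barrier notes B3/B6: open even in
    analytic rank 1 for non-CM curves, and the integer analogue (infinitely many non-Wieferich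
    primes to base `a`) is known only under abc (Silverman 1988). Heuristically TRUE (failures have
    probability `≍ 1/p`, density zero but infinitely many expected — which is also why the
    COFINITE version `SchneiderCofinite` of ideator 1 is heuristically FALSE and must not be used).
    NOT refutable; no junk reading found (`IsCyclotomicVariable`-normalised generators exist).
    Rank-0 remark for the lead: for `rank E(ℚ) = 0`, `L(E,1) ≠ 0`, stability at `p` ⟺ `X` finite
    ⟺ (no finite submodule) `Sel_{p^∞}(E/ℚ_∞) = 0`, which Greenberg LNM 1716 Thm 4.1 gives at every
    non-anomalous good ordinary `p ∤ Tam · #Sel_{p^∞}(E/ℚ)`; infinitely many NON-ANOMALOUS good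
    ordinary `p ≥ 5` exist by the tree's own sieve argument (`exists_good_ordinary_prime_holds`:
    primes `p ≡ 1 (mod 4)`, `p >` any bound, modulo which the 2-division cubic splits, give
    `4 ∣ #Ẽ(𝔽_p)`, so `a_p ≡ 2 (mod 4)`: ordinary AND non-anomalous) — so the rank-0 case of the
    stub is provable modulo Greenberg's theorem.
  - `stub_namedFacts`: conjunction of three named facts (modularity BCDT; BCS 2025 Thm 1.1.2(a) —
    statement re-read against the fact's docstring quote: `p > 3`, good ordinary, `E[p]`
    irreducible, equality in `Λ ⊗ ℚ_p` — matches; Greenberg 1999 control in corank form);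
    blocked on facts, consistent.
  - `stub_cofiniteIMC`: LANDED by the lead (p131521).
  - `stub_leverTrivial` (GLUE): TRUE — `Sel^{γ^p} = Sel^{γ}` dualises to `T·X = ω₁·X`
    (annihilators of the closed = open finite-index subgroups `(ω₁, p^k)·X` of the profinite
    `X = Hom(Sel_∞, ℚ/ℤ)`; continuity of characters of finite-index closed subgroups is the one
    delicate step, then Krull intersection), and Nakayama (`ω₁ = ν₁T`, `ν₁(0) = p ∈ 𝔪`, PROVED in the
    ideator sketch) kills `T·X`. Not refutable: `SelmerDualData` pins `X` to the full character
    group with `T = γ - 1` (fields `toDual`, `bijective`, `toDual_T_smul`), so no junk datum.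
  - `stub_leverOrder` (GLUE): TRUE modulo the control fact — `T·X = 0` makes `X` a finitely
    generated `ℤ_p`-module `ℤ_p^{r'} ⊕ F`, `char X = (T^{r'})` (finite `F` is pseudo-null),
    `r' = rank_{ℤ_p} X/TX = corank Sel_{p^∞}(E/ℚ) = rank + corank Ш[p^∞] = rank`; a generator of
    `(T^{rank})` is `unit · T^{rank}`, order `rank`. Not refutable.
  - JOINT SUFFICIENCY `PinchPrime_of`: kernel-checked in the skeleton (read: the stable prime is
    taken outside `B₁ ∪ B₂`, datum by `nonempty_selmerDualData_holds` +
    `module_finite_of_isCyclotomic`, principal `char` by `charIdeal_isPrincipal_holds`); no gap.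
    NOTE the asymmetry is essential: `Ш`-side COFINITE × height-side INFINITELY OFTEN meet; two
    "infinitely often" legs would not (§4 content theorem: the conjunction is needed at ONE prime).
* mutation summary: `IsElliptic`/`IsGloballyMinimal`/`Fact p.Prime`/`NeZero N` are typing
  prerequisites (`frobeniusTrace`, `IsOrdinaryAt`, `Gamma0`), not droppable; `5 ≤ p` droppable to
  `3 ≤ p` arithmetically (not in the tree: canonical-height facts are `p ≥ 5`); `IsOrdinaryAt` ↦
  good reduction: equivalent (§3); `∃ D` deletable: equivalent (§3); `∃ p` ↦ `∀ p`: the sibling crux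
  (open, resists); `∃ p` ↦ `∃ p ≤ B`: FALSE for every `B` (§1); `∀ W ∃ p` ↦ `∃ p ∀ W`: FALSE (§1).
-/

/-! ## §6 Compute probe — pinch primes curve by curve (PARI/GP 2.15.4, `kit compute`)

Pipeline (script `pinchjob/pinch.gp` of the seat folder): enumerate the box `a₁,a₃ ∈ {0,1}`,
`a₂ ∈ {-1,0,1}`, `|a₄| ≤ 60`, `|a₆| ≤ 120`, keep conductor `≤ 3000`, dedupe by minimal model, keep
`ellanalyticrank ≥ 2` with `ellrank` lower = upper = analytic rank (CERTIFIED Mordell–Weil rank `r`),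
add 389a1 and 5077a1; per curve take the least good ordinary `p ≥ 5` and compute
`msfromell → mspadicinit(M,p,n,0) → mspadicmoments → mspadicL(μ,0,k)`, `k = 0..r` (the `k`-th
`s`-derivative of `L_p(E,⟨·⟩^s)` at `s = 0`; same `T`-order as `L_p(E,T)`); "certified pinch" =
the `r`-th derivative is a non-zero `p`-adic number to precision `p^n` (⟹ `ord_T L_p ≤ r`; with
Kato's theorem `ord_T L_p ≥ corank Sel ≥ r` this is `ord_T L_p = r` EXACTLY) and the lower ones are
`O(p^n)`.

* j020798 — cancelled before start (lane clamp 0.5 h / 4 GB); j020833 (4 × gp, 900 MB PARI stack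
  each, n = 12): the enumeration found **189 curves of certified rank ≥ 2 with N ≤ 3000** in the box
  (all rank 2; plus 5077a1 of rank 3); the `p`-adic stage overflowed the 900 MB stack (`e_STACK`) on
  every conductor ≥ 1600 tried and the job was stopped by the memory watchdog after 160 s (peak RSS
  4.0 GB), but THREE curves completed, all CERTIFIED AT THE LEAST GOOD ORDINARY PRIME `p = 5`:
  389a1 `[0,1,1,-2,0]` (r = 2): derivatives `k = 0,1` are `O(5^12), O(5^11)`, `k = 2` non-zero of
  valuation 2; N = 709 `[0,-1,1,-2,0]` (r = 2): `O(5^12), O(5^11)`, valuation 3; N = 997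
  `[0,-1,1,-24,54]` (r = 2): `O(5^12), O(5^11)`, valuation 2. (In PARI's normalisation of `L_p`; since the
  `k`-th `s`-derivative is `k!·(log_p γ)^k·[T^k]L_p` once the lower coefficients vanish, valuation
  2 `= v_5(2!·(log_5 γ)²)` says `[T²]L_5` is a 5-adic UNIT for 389a1 and 997 — for 389a1 this agrees
  with Stein–Wuthrich 2013 §8 — while valuation 3 for 709 says `v_5([T²]L_5) = 1`, a non-unit
  leading coefficient: still a pinch prime, not a "sharp" one.) No inconsistency with Kato (no certified
  non-zero derivative below the rank) was observed.
* j020973 (v2: 4 × gp, 7 GB stack each, 32 GB, n = 10, wall 872 s, cpu 2938 s, peak RSS 28.9 GB; full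
  table `pinch_table_j020973.md` attached to the item as evidence): **189 curves (180 conductors
  389 ≤ N ≤ 3000, 188 of rank 2, 5077a1 of rank 3); 188/189 CERTIFIED PINCHED AT THEIR LEAST GOOD
  ORDINARY PRIME `p ≥ 5`** (158 at `p = 5`, 30 at `p = 7`; in every case the derivatives of order
  `< r` are `O(p^10), O(p^9)` (,`O(p^8)`), consistent with Kato, and the `r`-th is a certified non-zero
  `p`-adic number); **0 counter-indications**; 1 curve INCONCLUSIVE for memory reasons only
  (N = 2870 = 2·5·7·41, `[1,0,1,-39,86]`, rank 2: `5, 7 ∣ N`, least ordinary prime 11, `e_STACK` at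
  7 GB for `p = 11, 13`; single-curve re-run with a 60 GB stack: job j021239, evidence on the item
  when it ends). 5077a1 (rank 3): `O(5^10), O(5^9), O(5^8)`, third derivative of valuation 3 — sharp
  at `p = 5`. So in this sample the STRONG form "the least good ordinary prime `≥ 5` is already a
  pinch prime" has no exception, let alone the crux.
* SHARP versus PINCHED (for the picked line `SketchIdeator2`, whose stable primes are the sharp
  ones): writing `defect := v_p(r-th derivative) − r = v_p([T^r]L_p)` in PARI's Néron-period
  normalisation (`= 2·v_p(#Ẽ(𝔽_p)) + v_p(#Ш) + (v_p(Reg_p) − r) + v_p(Tam) − 2·v_p(#tors)` by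
  `p`-adic BSD), the 188 certified least-ordinary pinch points split as defect 0 (SHARP: `L_p =
  T^r · unit`, i.e. `μ = 0`, `λ = r`): **155**; defect 1: **26**; defect 2: **6**; defect 3: **1**
  (N = 1141 `[1,0,0,-27,94]` at `p = 5`); by prime: `p = 5`: 131/20/6/1, `p = 7`: 24/6/0/0. So at
  33/188 ≈ 18 % of least-ordinary pinch points the prime is PINCHING BUT NOT SHARP (anomalous `p`,
  `p ∣ Tam`, or a non-unit normalised regulator — the table does not separate these): "pinch" is
  strictly weaker than "sharp/stable" in practice, as the line's design (stability only INFINITELY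
  OFTEN) anticipates; none of this threatens `S`.
-/

end Summit.BirchSwinnertonDyer.BirchSwinnertonDyer.Cruxes.PinchPrime.Disproof

end
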